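import Literature.AlgebraicTopology.SingularHomology.HurewiczSimplexClass
import Literature.AlgebraicTopology.SingularHomology.StdSimplexHorn
import Literature.AlgebraicTopology.Homotopy.RelativeHomotopyGroups
import Mathlib.Topology.ContinuousMap.Basic
import HarnessLib

/-!
# The cone map `(I^{q+1}, ∂I^{q+1}, J^q) → (Δ^{q+1}, ∂Δ^{q+1}, Λ₀)` and descent of relative
null-homotopies to the simplex

Topic `Literature/AlgebraicTopology/Homotopy`. The tree's relative homotopy groups
`πₙ(X, A, a) = RelHomotopyGroup.Pi n X A a` (`RelativeHomotopyGroups.lean`) are classes of maps of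
triples `(Iⁿ, ∂Iⁿ, Jⁿ⁻¹) → (X, A, a)` (Hatcher, *Algebraic Topology* (2002), §4.1, p. 343), whereas
the chain-level arguments of `Literature/AlgebraicTopology/SingularHomology/` (Hurewicz theorems;
E. H. Spanier, *Algebraic Topology* (1966), Ch. 7 §§4–5) represent such classes by singular
simplices `(Δⁿ, Δ̇ⁿ, ·) → (X, A, ·)` (Spanier p. 391: "replace the triple `(Iⁿ, İⁿ, z₀)` … by the
homeomorphic triple `(Δⁿ, Δ̇ⁿ, v₀)`"). For the *absolute* groups the comparison is the pair
homeomorphism `cubeSimplexHomeo : (I^q, ∂I^q) ≅ (Δ^q, ∂Δ^q)` of `HurewiczSimplexClass.lean`. For the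
*relative* groups one needs a map of TRIPLES taking Hatcher's `J` to something manageable on the
simplex; this file provides it, everything PROVED (`[folklore]`):

* `SimplexCone.coneMap q : C(I^{q+1}, Δ^{q+1})`, `y ↦ (1 - y₀) · δ₀(κ_q(y₁, …, y_q)) + y₀ · v₀`:
  the free face `{y₀ = 0}` goes onto the `0`-th facet `δ₀(Δ^q)`, the part `J = {y₀ = 1} ∪ walls`
  of the boundary goes into the horn `Λ₀ = stdHorn 0` (all facets but the `0`-th), boundary to
  boundary and interior to interior (`coneMap_mem_stdBoundary_iff`); it is surjective and
  injective away from the top face `{y₀ = 1}`, which is collapsed to the vertex `v₀`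
  (`coneMap_eq_coneMap_iff`).
* `SimplexCone.descend`: a homotopy `H : I × I^{q+1} → X` constant along the fibres of `coneMap`
  descends to `I × Δ^{q+1}` (`id × coneMap` is a closed surjection from a compact space, hence a
  quotient map; Mathlib's `IsQuotientMap.lift`).
* `SimplexCone.relGenLoopOfSimplex`: a map `g : Δ^{q+1} → X` with `g(∂Δ) ⊆ A` and `g(Λ₀) = {a}`
  gives the relative loop `g ∘ coneMap ∈ RelGenLoop 0 A a`, and
  **`SimplexCone.exists_homotopy_const_of_subsingleton`**: if moreover `π_{q+1}(X, A, a) = 0`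
  (`Subsingleton (RelHomotopyGroup.Pi (q+1) X A a)`), then `g` is homotopic *as a map of pairs*
  `(Δ^{q+1}, ∂Δ^{q+1}) → (X, A)` to the constant map `a` (the null-homotopy through relative loops
  of `g ∘ coneMap` is constant `= a` on the collapsed face, so it descends). This is the step
  "`[α] = 0 ⟹ α` is homotopic (as a map of pairs) to a constant" of Spanier 1966, Thm. 7.2.1 /
  Hatcher 2002, p. 343 (compression criterion), read for simplices; the conversion into a homotopy
  *rel* `∂Δ` and the normalisation of an arbitrary map of pairs to one constant on the horn are in
  the sibling files `PrismTopRetraction.lean` and `HornNormalization.lean`.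

## References

* E. H. Spanier, *Algebraic Topology*, McGraw-Hill 1966 / Springer 1981, Ch. 7 §2 Thm. 1,
  Cor. 2 (p. 372); §4 p. 391. [Spanier1981]
* A. Hatcher, *Algebraic Topology*, CUP (2002), §4.1, p. 343 (compression criterion), p. 351
  (`Dⁿ` versus `Δⁿ`). [HatcherAT2002]
-/

noncomputable section

open Set Function
open scoped Topology unitInterval

namespace Literature.AlgebraicTopology.Homotopy

namespace SimplexCone

open Literature.AlgebraicTopology.SingularHomology

variable (q : ℕ)

/-! ### The cone map -/

/-- The last `q` coordinates `(y₁, …, y_q)` of a point of `I^{q+1}`. [folklore] -/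
def tail (y : Fin (q + 1) → I) : Fin q → I := fun j => y j.succ

/-- `tail` is continuous. [folklore] -/
lemma continuous_tail : Continuous (tail q) :=
  continuous_pi fun j => continuous_apply j.succ

/-- The point `κ_q(y₁, …, y_q) ∈ Δ^q` of the standard `q`-simplex attached to the tail of `y`, via
the pair homeomorphism `cubeSimplexHomeo q : (I^q, ∂I^q) ≅ (Δ^q, ∂Δ^q)`. [folklore] -/
def tailPt (y : Fin (q + 1) → I) : StdSimplex q := cubeSimplexHomeo q (tail q y)

/-- `tailPt` is continuous. [folklore] -/
lemma continuous_tailPt : Continuous (tailPt q) :=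
  (cubeSimplexHomeo q).continuous.comp (continuous_tail q)

/-- `tailPt y ∈ ∂Δ^q` iff the tail of `y` lies on `∂I^q`. [folklore] -/
lemma tailPt_mem_stdBoundary_iff (y : Fin (q + 1) → I) :
    tailPt q y ∈ stdBoundary q ↔ tail q y ∈ Cube.boundary (Fin q) :=
  cubeSimplexHomeo_mem_stdBoundary_iff _

/-- The coordinates of the cone map: `y₀` at the vertex `0`, and `(1 - y₀) · κ_q(tail y)` on the
opposite facet. [folklore] -/
def coneFun (y : Fin (q + 1) → I) : Fin (q + 2) → ℝ := fun i =>
  Fin.cases (y 0 : ℝ) (fun l => (1 - (y 0 : ℝ)) * (tailPt q y : Fin (q + 1) → ℝ) l) i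

/-- The `0`-th coordinate of the cone map is `y₀`. [folklore] -/
@[simp]
lemma coneFun_zero (y : Fin (q + 1) → I) : coneFun q y 0 = y 0 := rfl

/-- The other coordinates of the cone map. [folklore] -/
@[simp]
lemma coneFun_succ (y : Fin (q + 1) → I) (l : Fin (q + 1)) :
    coneFun q y l.succ = (1 - (y 0 : ℝ)) * (tailPt q y : Fin (q + 1) → ℝ) l := by
  simp [coneFun]

/-- The cone map lands in the standard simplex. [folklore] -/
lemma coneFun_mem (y : Fin (q + 1) → I) : coneFun q y ∈ stdSimplex ℝ (Fin (q + 2)) := by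
  refine ⟨fun i => ?_, ?_⟩
  · refine Fin.cases ?_ (fun l => ?_) i
    · rw [coneFun_zero]; exact unitInterval.nonneg _
    · rw [coneFun_succ]
      exact mul_nonneg (unitInterval.one_minus_nonneg _) (stdSimplex.zero_le (tailPt q y) l)
  · rw [Fin.sum_univ_succ]
    simp only [coneFun_zero, coneFun_succ]
    rw [← Finset.mul_sum, stdSimplex.sum_eq_one (tailPt q y), mul_one]
    ring

/-- **The cone map** `I^{q+1} → Δ^{q+1}`, `y ↦ (1 - y₀) · δ₀(κ_q(tail y)) + y₀ · v₀`: the cube as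
the cone on its free face `{y₀ = 0} ≅ I^q ≅ Δ^q ≅ δ₀(Δ^q)`, with cone point the top face
`{y₀ = 1}`, collapsed to the vertex `v₀` opposite to the `0`-th facet (compare Spanier 1966, Ch. 7
§4 p. 391, "a homeomorphism of `(Δⁿ, Δ̇ⁿ, v₀)` onto `(Iⁿ, İⁿ, z₀)`"). [folklore] -/
def coneMap : C(Fin (q + 1) → I, StdSimplex (q + 1)) where
  toFun y := ⟨coneFun q y, coneFun_mem q y⟩
  continuous_toFun := by
    refine Continuous.subtype_mk (continuous_pi fun i => ?_) _
    refine Fin.cases ?_ (fun l => ?_) i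
    · simp only [coneFun_zero]
      exact continuous_subtype_val.comp (continuous_apply 0)
    · simp only [coneFun_succ]
      exact ((continuous_const.sub (continuous_subtype_val.comp (continuous_apply 0))).mul
        (((continuous_apply l).comp continuous_subtype_val).comp (continuous_tailPt q)))

/-- Coordinates of the cone map (as a function). [folklore] -/
lemma coe_coneMap (y : Fin (q + 1) → I) :
    ((coneMap q y : StdSimplex (q + 1)) : Fin (q + 2) → ℝ) = coneFun q y := rfl

/-- The `0`-th coordinate of `coneMap y` is `y₀`. [folklore] -/
@[simp]
lemma coneMap_apply_zero (y : Fin (q + 1) → I) :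
    ((coneMap q y : StdSimplex (q + 1)) : Fin (q + 2) → ℝ) 0 = y 0 := rfl

/-- The `(l+1)`-st coordinate of `coneMap y` is `(1 - y₀) κ_q(tail y)_l`. [folklore] -/
@[simp]
lemma coneMap_apply_succ (y : Fin (q + 1) → I) (l : Fin (q + 1)) :
    ((coneMap q y : StdSimplex (q + 1)) : Fin (q + 2) → ℝ) l.succ =
      (1 - (y 0 : ℝ)) * (tailPt q y : Fin (q + 1) → ℝ) l :=
  coneFun_succ q y l

variable {q}

/-! ### Where the cone map sends the faces of the cube -/

/-- **The free face goes to the `0`-th facet**: if `y₀ = 0` then `coneMap y = δ₀(κ_q(tail y))`.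
[folklore] -/
lemma coneMap_of_apply_zero {y : Fin (q + 1) → I} (hy : y 0 = 0) :
    coneMap q y = stdFace 0 (tailPt q y) := by
  ext i
  refine Fin.cases ?_ (fun l => ?_) i
  · rw [coneMap_apply_zero, stdFace_apply_self, hy]; rfl
  · rw [coneMap_apply_succ, ← Fin.succAbove_zero, stdFace_apply_succAbove, hy]
    simp

/-- **The top face goes to the vertex**: if `y₀ = 1` then all coordinates of `coneMap y` but the
`0`-th vanish. [folklore] -/
lemma coneMap_apply_succ_of_apply_zero_eq_one {y : Fin (q + 1) → I} (hy : y 0 = 1)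
    (l : Fin (q + 1)) : ((coneMap q y : StdSimplex (q + 1)) : Fin (q + 2) → ℝ) l.succ = 0 := by
  rw [coneMap_apply_succ, hy]
  simp

/-- **A wall goes into a facet other than the `0`-th**: if the tail of `y` is on `∂I^q`, some
coordinate of `coneMap y` of positive index vanishes. [folklore] -/
lemma exists_coneMap_apply_succ_eq_zero {y : Fin (q + 1) → I}
    (hy : tail q y ∈ Cube.boundary (Fin q)) :
    ∃ l : Fin (q + 1), ((coneMap q y : StdSimplex (q + 1)) : Fin (q + 2) → ℝ) l.succ = 0 := by
  obtain ⟨l, hl⟩ := (tailPt_mem_stdBoundary_iff q y).2 hy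
  exact ⟨l, by rw [coneMap_apply_succ, hl, mul_zero]⟩

/-- **`J` goes into the horn `Λ₀`**: the top face and the walls of `I^{q+1}` (Hatcher's `J^q`,
`RelGenLoop.jBoundary 0`) are mapped into the union of the facets `δᵢ(Δ^q)`, `i ≠ 0`. [folklore] -/
lemma coneMap_mem_stdHorn {y : Fin (q + 1) → I} (hy : y ∈ RelGenLoop.jBoundary (0 : Fin (q + 1))) :
    coneMap q y ∈ stdHorn (n := q) 0 := by
  rcases hy with hy | ⟨j, hj, hj'⟩
  · exact ⟨(0 : Fin (q + 1)).succ, Fin.succ_ne_zero _,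
      coneMap_apply_succ_of_apply_zero_eq_one hy 0⟩
  · obtain ⟨j', rfl⟩ := Fin.exists_succ_eq.2 hj
    obtain ⟨l, hl⟩ := exists_coneMap_apply_succ_eq_zero (y := y) ⟨j', hj'⟩
    exact ⟨l.succ, Fin.succ_ne_zero _, hl⟩

/-- **Boundary to boundary**: `coneMap (∂I^{q+1}) ⊆ ∂Δ^{q+1}`. [folklore] -/
lemma coneMap_mem_stdBoundary {y : Fin (q + 1) → I} (hy : y ∈ Cube.boundary (Fin (q + 1))) :
    coneMap q y ∈ stdBoundary (q + 1) := by
  rcases (RelGenLoop.mem_boundary_iff (0 : Fin (q + 1)) y).1 hy with hy | hy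
  · exact ⟨0, by rw [coneMap_apply_zero, hy]; rfl⟩
  · exact stdHorn_subset_stdBoundary _ (coneMap_mem_stdHorn hy)

/-- **Interior to interior**: `coneMap y ∈ ∂Δ^{q+1}` only if `y ∈ ∂I^{q+1}`. [folklore] -/
lemma mem_boundary_of_coneMap_mem_stdBoundary {y : Fin (q + 1) → I}
    (hy : coneMap q y ∈ stdBoundary (q + 1)) : y ∈ Cube.boundary (Fin (q + 1)) := by
  obtain ⟨i, hi⟩ := hy
  revert hi
  refine Fin.cases ?_ (fun l => ?_) i
  · intro hi
    rw [coneMap_apply_zero] at hi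
    exact ⟨0, Or.inl (Subtype.ext hi)⟩
  · intro hi
    rw [coneMap_apply_succ] at hi
    rcases mul_eq_zero.1 hi with h | h
    · refine ⟨0, Or.inr (Subtype.ext ?_)⟩
      simp only [Set.Icc.coe_one]
      linarith
    · obtain ⟨j, hj⟩ := (tailPt_mem_stdBoundary_iff q y).1 ⟨l, h⟩
      exact ⟨j.succ, hj⟩

/-- **`coneMap` is a map of pairs in both directions**: `coneMap y ∈ ∂Δ^{q+1} ↔ y ∈ ∂I^{q+1}`.
[folklore] -/
theorem coneMap_mem_stdBoundary_iff (y : Fin (q + 1) → I) :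
    coneMap q y ∈ stdBoundary (q + 1) ↔ y ∈ Cube.boundary (Fin (q + 1)) :=
  ⟨mem_boundary_of_coneMap_mem_stdBoundary, coneMap_mem_stdBoundary⟩

/-! ### Fibres and surjectivity -/

/-- **The fibres of the cone map**: two points have the same image iff they are equal or both lie
on the top face `{y₀ = 1}` (which is collapsed to the vertex `v₀`). [folklore] -/
theorem coneMap_eq_coneMap_iff (y y' : Fin (q + 1) → I) :
    coneMap q y = coneMap q y' ↔ y = y' ∨ (y 0 = 1 ∧ y' 0 = 1) := by
  constructor
  · intro h
    have h0 : y 0 = y' 0 := by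
      have := congrArg (fun t : StdSimplex (q + 1) => (t : Fin (q + 2) → ℝ) 0) h
      exact Subtype.ext (by simpa using this)
    by_cases h1 : y 0 = 1
    · exact Or.inr ⟨h1, h0 ▸ h1⟩
    · left
      have hne : (1 - (y 0 : ℝ)) ≠ 0 := by
        intro h2
        apply h1
        exact Subtype.ext (by simp only [Set.Icc.coe_one]; linarith)
      have htail : tailPt q y = tailPt q y' := by
        ext l
        have := congrArg (fun t : StdSimplex (q + 1) => (t : Fin (q + 2) → ℝ) l.succ) h
        simp only [coneMap_apply_succ, ← h0] at this
        exact mul_left_cancel₀ hne this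
      have htail' : tail q y = tail q y' := (cubeSimplexHomeo q).injective htail
      funext i
      refine Fin.cases h0 (fun j => ?_) i
      exact congrFun htail' j
  · rintro (rfl | ⟨h, h'⟩)
    · rfl
    · ext i
      refine Fin.cases ?_ (fun l => ?_) i
      · rw [coneMap_apply_zero, coneMap_apply_zero, h, h']
      · rw [coneMap_apply_succ_of_apply_zero_eq_one h, coneMap_apply_succ_of_apply_zero_eq_one h']

/-- The point of `I^{q+1}` with first coordinate `s` and tail `κ_q⁻¹(z)`. [folklore] -/
def conePt (s : I) (z : StdSimplex q) : Fin (q + 1) → I :=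
  Fin.cases s (fun j => (cubeSimplexHomeo q).symm z j)

/-- The first coordinate of `conePt s z` is `s`. [folklore] -/
@[simp]
lemma conePt_zero (s : I) (z : StdSimplex q) : conePt s z 0 = s := rfl

/-- The tail point of `conePt s z` is `z`. [folklore] -/
@[simp]
lemma tailPt_conePt (s : I) (z : StdSimplex q) : tailPt q (conePt s z) = z := by
  change cubeSimplexHomeo q (fun j => conePt s z j.succ) = z
  have h : (fun j => conePt s z j.succ) = (cubeSimplexHomeo q).symm z := by
    funext j; simp [conePt]
  rw [h, Homeomorph.apply_symm_apply]

/-- **The cone map is surjective.** A point `t` with `t₀ < 1` is the image of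
`(t₀, κ_q⁻¹(t' / (1 - t₀)))`, `t'` the remaining coordinates; the vertex `t₀ = 1` is the image
of the top face. [folklore] -/
theorem coneMap_surjective : Function.Surjective (coneMap q) := by
  intro t
  have ht0 : t 0 ≤ 1 := stdSimplex.le_one t 0
  have hsum : t 0 + ∑ l : Fin (q + 1), t l.succ = 1 := by
    have h := stdSimplex.sum_eq_one t
    rwa [Fin.sum_univ_succ] at h
  rcases ht0.eq_or_lt with h1 | h1
  · -- the vertex: image of the top face
    refine ⟨fun _ => 1, ?_⟩
    have hrest : ∀ l : Fin (q + 1), t l.succ = 0 := by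
      have hs : ∑ l : Fin (q + 1), t l.succ = 0 := by linarith
      intro l
      exact (Finset.sum_eq_zero_iff_of_nonneg (fun l _ => stdSimplex.zero_le t l.succ)).1 hs l
        (Finset.mem_univ l)
    ext i
    refine Fin.cases ?_ (fun l => ?_) i
    · rw [coneMap_apply_zero, h1]; rfl
    · rw [coneMap_apply_succ_of_apply_zero_eq_one rfl, hrest]
  · -- a point below the vertex
    have hpos : 0 < 1 - t 0 := by linarith
    let z : StdSimplex q := ⟨fun l => (1 - t 0)⁻¹ * t l.succ,
      fun l => mul_nonneg (inv_nonneg.2 hpos.le) (stdSimplex.zero_le t _), by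
        rw [← Finset.mul_sum, show ∑ l : Fin (q + 1), t l.succ = 1 - t 0 by linarith,
          inv_mul_cancel₀ hpos.ne']⟩
    refine ⟨conePt ⟨t 0, stdSimplex.zero_le t 0, ht0⟩ z, ?_⟩
    ext i
    refine Fin.cases ?_ (fun l => ?_) i
    · rfl
    · rw [coneMap_apply_succ, tailPt_conePt, conePt_zero]
      change (1 - t 0) * ((1 - t 0)⁻¹ * t l.succ) = _
      rw [← mul_assoc, mul_inv_cancel₀ hpos.ne', one_mul]

/-! ### Descent of homotopies along the cone map -/

variable {X : Type*} [TopologicalSpace X]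

variable (q) in
/-- `id × coneMap : I × I^{q+1} → I × Δ^{q+1}`. [folklore] -/
def prodConeMap : C(I × (Fin (q + 1) → I), I × StdSimplex (q + 1)) :=
  (ContinuousMap.id I).prodMap (coneMap q)

/-- `prodConeMap (s, y) = (s, coneMap y)`. [folklore] -/
@[simp]
lemma prodConeMap_apply (s : I) (y : Fin (q + 1) → I) : prodConeMap q (s, y) = (s, coneMap q y) := rfl

/-- `id × coneMap` is a quotient map (a continuous surjection from a compact space to a Hausdorff
space). [folklore] -/
theorem isQuotientMap_prodConeMap : _root_.Topology.IsQuotientMap (prodConeMap q) :=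
  _root_.Topology.IsQuotientMap.of_surjective_continuous
    (fun ⟨s, t⟩ => by
      obtain ⟨y, rfl⟩ := coneMap_surjective t
      exact ⟨(s, y), rfl⟩)
    (prodConeMap q).continuous

/-- **Descent.** A homotopy `H : I × I^{q+1} → X` taking equal values on points with the same
image under the cone map (i.e. constant in `y` on each slice of the top face) factors through
`id × coneMap`: `H = H̃ ∘ (id × coneMap)` for a (unique) continuous `H̃ : I × Δ^{q+1} → X`.
[folklore] -/
theorem descend (H : C(I × (Fin (q + 1) → I), X))
    (hH : ∀ (s : I) (y y' : Fin (q + 1) → I), coneMap q y = coneMap q y' → H (s, y) = H (s, y')) :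
    ∃ G : C(I × StdSimplex (q + 1), X), ∀ s y, G (s, coneMap q y) = H (s, y) := by
  have hfac : Function.FactorsThrough H (prodConeMap q) := by
    rintro ⟨s, y⟩ ⟨s', y'⟩ h
    simp only [prodConeMap_apply, Prod.mk.injEq] at h
    obtain ⟨rfl, h⟩ := h
    exact hH s y y' h
  refine ⟨isQuotientMap_prodConeMap.lift H hfac, fun s y => ?_⟩
  exact DFunLike.congr_fun (isQuotientMap_prodConeMap.lift_comp H hfac) (s, y)

/-! ### Relative loops from simplices constant on the horn -/

variable {A : Set X} {a : A}

/-- **A simplex constant on the horn is a relative loop.** For `g : Δ^{q+1} → X` with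
`g(∂Δ^{q+1}) ⊆ A` and `g ≡ a` on the horn `Λ₀`, the composite `g ∘ coneMap` is a map of triples
`(I^{q+1}, ∂I^{q+1}, J^q) → (X, A, a)`, i.e. an element of `RelGenLoop 0 A a` representing a class
of `π_{q+1}(X, A, a)` (Spanier 1966, p. 391, for the triple `(Δⁿ, Δ̇ⁿ, ·)`). [folklore] -/
def relGenLoopOfSimplex (g : C(StdSimplex (q + 1), X)) (hg : ∀ t ∈ stdBoundary (q + 1), g t ∈ A)
    (hgΛ : ∀ t ∈ stdHorn (n := q) 0, g t = a) : RelGenLoop (0 : Fin (q + 1)) A a :=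
  ⟨g.comp (coneMap q),
    fun _ hy => hg _ (coneMap_mem_stdBoundary ⟨0, Or.inl hy⟩),
    fun _ hy => hgΛ _ (coneMap_mem_stdHorn hy)⟩

/-- `relGenLoopOfSimplex g _ _ y = g (coneMap y)`. [folklore] -/
@[simp]
lemma relGenLoopOfSimplex_apply (g : C(StdSimplex (q + 1), X)) (hg : ∀ t ∈ stdBoundary (q + 1), g t ∈ A)
    (hgΛ : ∀ t ∈ stdHorn (n := q) 0, g t = a) (y : Fin (q + 1) → I) :
    relGenLoopOfSimplex g hg hgΛ y = g (coneMap q y) := rfl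

/-- **A relative null-homotopy descends to the simplex.** If `g : Δ^{q+1} → X` maps `∂Δ^{q+1}`
into `A` and the horn `Λ₀` to the point `a`, and `π_{q+1}(X, A, a) = 0`, then `g` is homotopic,
through maps of pairs `(Δ^{q+1}, ∂Δ^{q+1}) → (X, A)`, to the constant map `a`: the null-homotopy
of the relative loop `g ∘ coneMap` through relative loops is constant `= a` on the top face of the
cube (part of `J`), hence factors through the cone map (Spanier 1966, Thm. 7.2.1, "`[α] = 0` …
there is a homotopy `H : (Eⁿ, Sⁿ⁻¹, p₀) × I → (X, A, x₀)` from `α` to the constant map"; Hatcher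
2002, p. 343). [cite: Spanier1981, Ch. 7 §2 Thm. 1] -/
theorem exists_homotopy_const_of_subsingleton (g : C(StdSimplex (q + 1), X))
    (hg : ∀ t ∈ stdBoundary (q + 1), g t ∈ A) (hgΛ : ∀ t ∈ stdHorn (n := q) 0, g t = a)
    [Subsingleton (RelHomotopyGroup.Pi (q + 1) X A a)] :
    ∃ G : C(I × StdSimplex (q + 1), X), (∀ t, G (0, t) = g t) ∧ (∀ t, G (1, t) = a) ∧
      ∀ (s : I), ∀ t ∈ stdBoundary (q + 1), G (s, t) ∈ A := by
  set p := relGenLoopOfSimplex g hg hgΛ with hp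
  haveI : Subsingleton (Quotient (RelGenLoop.setoid (0 : Fin (q + 1)) A a)) :=
    inferInstanceAs (Subsingleton (RelHomotopyGroup.Pi (q + 1) X A a))
  have hpc : RelGenLoop.Homotopic p (RelGenLoop.const (0 : Fin (q + 1)) A a) :=
    (RelHomotopyGroup.mk_eq_default_iff p).1 (Subsingleton.elim _ _)
  obtain ⟨H⟩ := hpc
  -- `H` is constant along the fibres of the cone map
  have hH : ∀ (s : I) (y y' : Fin (q + 1) → I), coneMap q y = coneMap q y' →
      H (s, y) = H (s, y') := by
    intro s y y' h
    rcases (coneMap_eq_coneMap_iff y y').1 h with rfl | ⟨hy, hy'⟩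
    · rfl
    · have h1 : H (s, y) = a := (H.prop' s).2 y (Or.inl hy)
      have h2 : H (s, y') = a := (H.prop' s).2 y' (Or.inl hy')
      exact h1.trans h2.symm
  obtain ⟨G, hG⟩ := descend H.toContinuousMap hH
  refine ⟨G, fun t => ?_, fun t => ?_, fun s t ht => ?_⟩
  · obtain ⟨y, rfl⟩ := coneMap_surjective t
    rw [hG]
    exact H.apply_zero y
  · obtain ⟨y, rfl⟩ := coneMap_surjective t
    rw [hG]
    exact H.apply_one y
  · obtain ⟨y, rfl⟩ := coneMap_surjective t
    rw [hG]
    have hy : y ∈ Cube.boundary (Fin (q + 1)) := mem_boundary_of_coneMap_mem_stdBoundary ht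
    exact RelGenLoop.apply_mem_of_mem_boundary ⟨H.toContinuousMap.curry s, H.prop' s⟩ hy

end SimplexCone

end Literature.AlgebraicTopology.Homotopy

end
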